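import Mathlib.Topology.Algebra.Category.ProfiniteGrp.Completion
import Mathlib.Topology.Algebra.Group.Basic
import Mathlib.Topology.Algebra.ContinuousMonoidHom
import Mathlib.GroupTheory.FreeGroup.IsFreeGroup
import Mathlib.GroupTheory.PresentedGroup
import Mathlib.GroupTheory.Abelianization.Defs
import Mathlib.GroupTheory.Commutator.Basic
import Mathlib.GroupTheory.SpecificGroups.Cyclic
import Mathlib.GroupTheory.Index
import Mathlib.Algebra.Group.Subgroup.Pointwise
import HarnessLib

/-!
# [IUTchI] §2: profinite conjugates of discrete subgroups (Theorem 2.6, Lemma 2.7, Corollary 2.8)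

Mochizuki, *Inter-universal Teichmüller theory I: construction of Hodge theaters*, kurims
manuscript (May 2020), §2 "Complements on Tempered Coverings", kurims pp. 56–60
[cite: Mochizuki2012, §2 pp.56-60] (D-0012 claim key; the series' status is DISPUTED — the
three items typed here are, however, plain combinatorial / profinite group theory: "discrete
analogues" of Prop. 2.4 / Cor. 2.5 "which may be regarded as generalizations of [André], Lemma
3.2.1; [EtTh], Lemma 2.17, (i)" (p. 56)).  STATEMENTS-FIRST: every printed statement is a named
`Prop` (`def … : Prop`, never asserted); the only `theorem`s are formal consequences we prove
here (Remark 2.8.1: "Corollary 2.8 is an immediate consequence of Theorem 2.6").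

* `IsFreeOfFiniteRank`, `surfaceRelator`, `SurfaceGroup`, `IsOrientableSurfaceGroup` — "a free
  discrete group of finite rank or an orientable surface group [i.e., a fundamental group of a
  compact orientable topological surface of genus ≥ 2]" (Thm 2.6, p. 56), the surface group being
  given by its standard one-relator presentation `⟨a₁, b₁, …, a_g, b_g | ∏ [a_i, b_i]⟩`;
* `profiniteCompletion F` = `F̂`, `toCompletion F : F → F̂` (Mathlib's
  `ProfiniteGrp.ProfiniteCompletion`), `ZHat` = `ℤ̂`;
* Theorem 2.6 — `ProfiniteConjugatesOfDiscreteSubgroups`; Remark 2.6.1 —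
  `ProfiniteConjugateNeedNotNormalize`;
* Lemma 2.7 (i)–(vii) — `FreeOrSurface.twoGeneratedSubgroupFree`, `….separatesInAbelianization`,
  `….rankTwoInAbelianization`, `….abelianSubgroupCyclic`, `….zHatQuotientNormallyTerminal`,
  `….centralizerCommutatorKernelTrivial`, `….autFixingCommutatorKernelTrivial`;
* Corollary 2.8 — `SubgroupsOfComplexHyperbolicPi1`, deduced from Theorem 2.6 in
  `subgroupsOfComplexHyperbolicPi1_of_thm26` (Remark 2.8.1).

Design / faithfulness notes.  (1) "Since `F` is residually finite … we shall write
`H, G ⊆ F ⊆ F̂`": we do not silently identify `F` with its image; every containment is written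
through the canonical map `η : F → F̂` (`toCompletion`), so no statement depends on injectivity of
`η` (residual finiteness, [Config] Prop. 7.1 (ii), is not re-typed here).  (2) "`γ ∈ F · N_{F̂}(H_G)`,
i.e., `γ · H_G · γ⁻¹ = δ · H_G · δ⁻¹` for some `δ ∈ F`" is typed in the second ("i.e.") form, on
the image `η(H_G) ⊆ F̂`.  (3) In Lemma 2.7 (iii) "generate a free abelian subgroup of rank two"
is typed as "satisfy no nontrivial relation `aⁱ bʲ = 1`".  (4) Lemma 2.7 (v)–(vii) concern the
profinite completion `Ĝ`; `Ĝ^{ab}` there is the PROFINITE abelianization, so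
`N̂ = Ker(Ĝ ↠ Ĝ^{ab})` is typed as the closure of the commutator subgroup of `Ĝ`, and an
"automorphism of the profinite group `Ĝ`" as a `ContinuousMulEquiv`.  (5) Corollary 2.8 is
stated for an abstract group `Π_Z` that is free of finite rank or an orientable surface group —
the classical description of the topological fundamental group of a hyperbolic curve over `ℂ`
(non-proper, resp. proper case), which is exactly what makes Theorem 2.6 applicable with
`H ⊆ F = G = Π_Z` (Remark 2.8.1); the complex-analytic definition of `Π_Z` is not re-typed
(TODO-merge:abc-iut-L4-t1, π₁ interface).  No printed statement is strengthened.
-/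

namespace Literature.IUT.HodgeTheaters

open CategoryTheory Pointwise Topology

universe u

/-! ### Free groups of finite rank, orientable surface groups (Thm 2.6, p. 56) -/

/-- `G` is a *free [discrete] group of finite rank*: `G ≅ F_n` for some `n` (Thm 2.6, p. 56).
[cite: Mochizuki2012, Thm 2.6 p.56] -/
def IsFreeOfFiniteRank (G : Type u) [Group G] : Prop :=
  ∃ n : ℕ, Nonempty (G ≃* FreeGroup (Fin n))

/-- The surface relator `∏_{i < g} [a_i, b_i]` in the free group on `a_i := inl i`,
`b_i := inr i`, `i < g`. [cite: Mochizuki2012, Thm 2.6 p.56] -/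
def surfaceRelator (g : ℕ) : FreeGroup (Fin g ⊕ Fin g) :=
  ((List.finRange g).map fun i =>
    (FreeGroup.of (Sum.inl i) : FreeGroup (Fin g ⊕ Fin g)) * FreeGroup.of (Sum.inr i) *
      (FreeGroup.of (Sum.inl i))⁻¹ * (FreeGroup.of (Sum.inr i))⁻¹).prod

/-- The *orientable surface group of genus `g`*: the fundamental group of a compact orientable
topological surface of genus `g`, via its standard presentation
`⟨a₁, b₁, …, a_g, b_g | [a₁, b₁] ⋯ [a_g, b_g] = 1⟩` (Thm 2.6, p. 56: "[i.e., a fundamental group of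
a compact orientable topological surface of genus ≥ 2]"). [cite: Mochizuki2012, Thm 2.6 p.56] -/
abbrev SurfaceGroup (g : ℕ) : Type :=
  PresentedGroup ({surfaceRelator g} : Set (FreeGroup (Fin g ⊕ Fin g)))

/-- `G` is an *orientable surface group*: isomorphic to the surface group of some genus `g ≥ 2`
(Thm 2.6, p. 56). [cite: Mochizuki2012, Thm 2.6 p.56] -/
def IsOrientableSurfaceGroup (G : Type u) [Group G] : Prop :=
  ∃ g : ℕ, 2 ≤ g ∧ Nonempty (G ≃* SurfaceGroup g)

/-- "A group as in Theorem 2.6" for the purposes of Lemma 2.7: either a free discrete group of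
finite rank or an orientable surface group (p. 57). [cite: Mochizuki2012, Lem 2.7 p.57] -/
def IsFreeOrSurface (G : Type u) [Group G] : Prop :=
  IsFreeOfFiniteRank G ∨ IsOrientableSurfaceGroup G

/-! ### Profinite completions (p. 56) -/

/-- `F̂`: the profinite completion of the [discrete] group `F` (p. 56), Mathlib's
`ProfiniteGrp.ProfiniteCompletion.completion`. [cite: Mochizuki2012, Thm 2.6 p.56] -/
noncomputable abbrev profiniteCompletion (F : Type u) [Group F] : ProfiniteGrp.{u} :=
  ProfiniteGrp.ProfiniteCompletion.completion (GrpCat.of F)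

/-- The canonical homomorphism `η : F → F̂` (injective iff `F` is residually finite; the text
writes `F ⊆ F̂` for a residually finite `F`, p. 56). [cite: Mochizuki2012, Thm 2.6 p.56] -/
noncomputable abbrev toCompletion (F : Type u) [Group F] : F →* profiniteCompletion F :=
  (ProfiniteGrp.ProfiniteCompletion.eta (GrpCat.of F)).hom

/-- `ℤ̂`, the profinite completion of `ℤ` (Lemma 2.7 (v), p. 57). [cite: Mochizuki2012, Lem 2.7(v) p.57] -/
noncomputable abbrev ZHat : Type := profiniteCompletion (Multiplicative ℤ)

/-! ### Theorem 2.6 and Remark 2.6.1 (pp. 56–57) -/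

/-- **Theorem 2.6 (Profinite Conjugates of Discrete Subgroups)**, p. 56, as a named statement.
Let `F` be a group containing a subgroup of finite index `G ⊆ F` that is either a free discrete
group of finite rank or an orientable surface group; `H ⊆ F` an infinite subgroup; write
`η : F → F̂` for the map to the profinite completion and `H_G := H ∩ G`.  Let `γ ∈ F̂` be such
that `γ · η(H) · γ⁻¹ ⊆ η(F)`.  Then (a) `γ · η(H_G) · γ⁻¹ = η(δ) · η(H_G) · η(δ)⁻¹` for some
`δ ∈ F` [the text: "`γ ∈ F · N_{F̂}(H_G)`, i.e., …"], and (b) if, moreover, `H_G` is nonabelian,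
then `γ ∈ η(F)`.  A `Prop`-valued definition: NOT asserted here.
[cite: Mochizuki2012, Thm 2.6 p.56] -/
def ProfiniteConjugatesOfDiscreteSubgroups : Prop :=
  ∀ (F : Type u) [Group F] (G H : Subgroup F), G.FiniteIndex → IsFreeOrSurface G →
    (H : Set F).Infinite →
    ∀ γ : profiniteCompletion F,
      (∀ h ∈ H, γ * toCompletion F h * γ⁻¹ ∈ (toCompletion F).range) →
      (∃ δ : F, MulAut.conj γ • (H ⊓ G).map (toCompletion F) =
          MulAut.conj (toCompletion F δ) • (H ⊓ G).map (toCompletion F)) ∧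
      ((∃ x ∈ H ⊓ G, ∃ y ∈ H ⊓ G, x * y ≠ y * x) → γ ∈ (toCompletion F).range)

/-- The "`γ ∈ F · N_{F̂}(H_G)`" form of conclusion (a) of Theorem 2.6 follows from the "i.e." form
`γ · H_G · γ⁻¹ = δ · H_G · δ⁻¹`: then `η(δ)⁻¹ γ` normalises `η(H_G)` (p. 56).
[cite: Mochizuki2012, Thm 2.6 p.56] -/
theorem mem_mul_normalizer_of_conj_eq {P : Type u} [Group P] (K : Subgroup P) (γ d : P)
    (h : MulAut.conj γ • K = MulAut.conj d • K) :
    ∃ n ∈ Subgroup.normalizer (K : Set P), γ = d * n := by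
  refine ⟨d⁻¹ * γ, ?_, by group⟩
  have hK : MulAut.conj (d⁻¹ * γ) • K = K := by
    rw [map_mul, mul_smul, h, ← mul_smul, ← map_mul, inv_mul_cancel, map_one, one_smul]
  rw [Subgroup.mem_set_normalizer_iff]
  intro x
  have key : x ∈ K ↔ MulAut.conj (d⁻¹ * γ) • x ∈ K := by
    constructor
    · intro hx
      have hx' := Subgroup.smul_mem_pointwise_smul x (MulAut.conj (d⁻¹ * γ)) K hx
      rwa [hK] at hx'
    · intro hx
      have hx' : MulAut.conj (d⁻¹ * γ) • x ∈ MulAut.conj (d⁻¹ * γ) • K := by rwa [hK]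
      exact Subgroup.smul_mem_pointwise_smul_iff.mp hx'
  simpa only [MulAut.smul_def, MulAut.conj_apply, SetLike.mem_coe] using key

/-- **Remark 2.6.1**, p. 57, as a named statement: in the situation of Theorem 2.6, if `H_G` is
abelian then — unlike the tempered case of Proposition 2.4! — it is NOT necessarily the case that
`F = γ⁻¹ · F · γ`; i.e. there exist data as in Theorem 2.6 with `H_G` abelian and
`γ⁻¹ · η(F) · γ ≠ η(F)`.  Not asserted here. [cite: Mochizuki2012, Rmk 2.6.1 p.57] -/
def ProfiniteConjugateNeedNotNormalize : Prop :=
  ∃ (F : Type u) (_ : Group F) (G H : Subgroup F), G.FiniteIndex ∧ IsFreeOrSurface G ∧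
    (H : Set F).Infinite ∧ (∀ x ∈ H ⊓ G, ∀ y ∈ H ⊓ G, x * y = y * x) ∧
    ∃ γ : profiniteCompletion F,
      (∀ h ∈ H, γ * toCompletion F h * γ⁻¹ ∈ (toCompletion F).range) ∧
      MulAut.conj γ⁻¹ • (toCompletion F).range ≠ (toCompletion F).range

/-! ### Lemma 2.7 (Well-known Properties of Free Groups and Orientable Surface Groups), pp. 57–58 -/

namespace FreeOrSurface

/-- **Lemma 2.7 (i)**, p. 57: for `G` free of finite rank or an orientable surface group, any
subgroup of `G` generated by two elements of `G` is free.  Not asserted here.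
[cite: Mochizuki2012, Lem 2.7(i) p.57] -/
def twoGeneratedSubgroupFree : Prop :=
  ∀ (G : Type u) [Group G], IsFreeOrSurface G →
    ∀ x y : G, IsFreeGroup (Subgroup.closure ({x, y} : Set G))

/-- **Lemma 2.7 (ii)**, p. 57: for `x ∈ G`, `x ≠ 1`, there exists a finite index subgroup
`G₁ ⊆ G` with `x ∈ G₁` such that `x` has nontrivial image in the abelianization `G₁^{ab}`.
Not asserted here. [cite: Mochizuki2012, Lem 2.7(ii) p.57] -/
def separatesInAbelianization : Prop :=
  ∀ (G : Type u) [Group G], IsFreeOrSurface G →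
    ∀ x : G, x ≠ 1 → ∃ (G₁ : Subgroup G) (hx : x ∈ G₁), G₁.FiniteIndex ∧
      Abelianization.of (⟨x, hx⟩ : G₁) ≠ 1

/-- **Lemma 2.7 (iii)**, p. 57: for noncommuting `x, y ∈ G` there exist a finite index subgroup
`G₁ ⊆ G` and a positive integer `n` with `xⁿ, yⁿ ∈ G₁` such that the images of `xⁿ` and `yⁿ` in
`G₁^{ab}` generate a free abelian subgroup of rank two [typed: satisfy no nontrivial relation].
Not asserted here. [cite: Mochizuki2012, Lem 2.7(iii) p.57] -/
def rankTwoInAbelianization : Prop :=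
  ∀ (G : Type u) [Group G], IsFreeOrSurface G →
    ∀ x y : G, x * y ≠ y * x → ∃ (G₁ : Subgroup G) (n : ℕ) (hx : x ^ n ∈ G₁) (hy : y ^ n ∈ G₁),
      G₁.FiniteIndex ∧ 0 < n ∧
      ∀ i j : ℤ, Abelianization.of (⟨x ^ n, hx⟩ : G₁) ^ i * Abelianization.of (⟨y ^ n, hy⟩ : G₁) ^ j = 1
        → i = 0 ∧ j = 0

/-- **Lemma 2.7 (iv)**, p. 57: any abelian subgroup of `G` is cyclic.  Not asserted here.
[cite: Mochizuki2012, Lem 2.7(iv) p.57] -/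
def abelianSubgroupCyclic : Prop :=
  ∀ (G : Type u) [Group G], IsFreeOrSurface G →
    ∀ J : Subgroup G, (∀ a ∈ J, ∀ b ∈ J, a * b = b * a) → IsCyclic J

/-- **Lemma 2.7 (v)**, p. 57: let `T̂ ⊆ Ĝ` be a closed subgroup such that there exists a
continuous surjection of topological groups `Ĝ ↠ ℤ̂` that induces an isomorphism `T̂ ⥲ ℤ̂`; then
`T̂` is normally terminal in `Ĝ` [`N_{Ĝ}(T̂) = T̂`].  Not asserted here.
[cite: Mochizuki2012, Lem 2.7(v) p.57] -/
def zHatQuotientNormallyTerminal : Prop :=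
  ∀ (G : Type u) [Group G], IsFreeOrSurface G →
    ∀ (T : Subgroup (profiniteCompletion G)), IsClosed (T : Set (profiniteCompletion G)) →
      (∃ φ : profiniteCompletion G →* ZHat, Continuous φ ∧ Function.Surjective φ ∧
        Function.Bijective (φ.comp T.subtype)) →
      Subgroup.normalizer (T : Set (profiniteCompletion G)) = T

/-- `N̂ ⊆ Ĝ`: the kernel of the natural surjection `Ĝ ↠ Ĝ^{ab}` onto the [profinite]
abelianization, i.e. the closure of the commutator subgroup of `Ĝ` (Lemma 2.7 (vi), p. 58).
[cite: Mochizuki2012, Lem 2.7(vi) p.58] -/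
noncomputable def commutatorKernel (G : Type u) [Group G] : Subgroup (profiniteCompletion G) :=
  (commutator (profiniteCompletion G)).topologicalClosure

/-- **Lemma 2.7 (vi)**, p. 58: suppose `G` nonabelian; then the centralizer `Z_{Ĝ}(N̂)` of
`N̂ = Ker(Ĝ ↠ Ĝ^{ab})` in `Ĝ` is trivial.  Not asserted here. [cite: Mochizuki2012, Lem 2.7(vi) p.58] -/
def centralizerCommutatorKernelTrivial : Prop :=
  ∀ (G : Type u) [Group G], IsFreeOrSurface G → (∃ x y : G, x * y ≠ y * x) →
    Subgroup.centralizer (commutatorKernel G : Set (profiniteCompletion G)) = ⊥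

/-- **Lemma 2.7 (vii)**, p. 58: in the notation of (vi), an automorphism `α` of the profinite
group `Ĝ` that preserves and restricts to the identity on `N̂` is the identity automorphism of
`Ĝ`.  Not asserted here. [cite: Mochizuki2012, Lem 2.7(vii) p.58] -/
def autFixingCommutatorKernelTrivial : Prop :=
  ∀ (G : Type u) [Group G], IsFreeOrSurface G → (∃ x y : G, x * y ≠ y * x) →
    ∀ α : profiniteCompletion G ≃ₜ* profiniteCompletion G,
      (∀ n ∈ commutatorKernel G, α n = n) → ∀ z : profiniteCompletion G, α z = z

/-- The formal step "(vi) ⇒ (vii)" printed on p. 59: if `x ∈ Ĝ`, `y ∈ N̂`, then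
`x y x⁻¹ = α(x y x⁻¹) = α(x) y α(x)⁻¹`, so `α(x) x⁻¹ ∈ Z_{Ĝ}(N̂) = {1}`.  We prove this
implication between the two named statements. [cite: Mochizuki2012, Lem 2.7(vii) p.59] -/
theorem autFixingCommutatorKernelTrivial_of_centralizer
    (h : centralizerCommutatorKernelTrivial.{u}) : autFixingCommutatorKernelTrivial.{u} := by
  intro G _ hG hna α hα z
  have hZ := h G hG hna
  haveI hN : (commutatorKernel G).Normal :=
    Subgroup.is_normal_topologicalClosure (commutator (profiniteCompletion G))
  -- `α z * z⁻¹` centralises `N̂`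
  have hmem : α z * z⁻¹ ∈
      Subgroup.centralizer (commutatorKernel G : Set (profiniteCompletion G)) := by
    rw [Subgroup.mem_centralizer_iff]
    intro y hy
    have hy' : z⁻¹ * y * z⁻¹⁻¹ ∈ commutatorKernel G := hN.conj_mem y hy z⁻¹
    rw [inv_inv] at hy'
    have h1 : (α z)⁻¹ * y * α z = z⁻¹ * y * z := by
      have h0 := hα _ hy'
      rwa [map_mul, map_mul, map_inv, hα y hy] at h0
    calc y * (α z * z⁻¹) = α z * ((α z)⁻¹ * y * α z) * z⁻¹ := by group
      _ = α z * (z⁻¹ * y * z) * z⁻¹ := by rw [h1]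
      _ = α z * z⁻¹ * y := by group
  rw [hZ, Subgroup.mem_bot] at hmem
  exact mul_inv_eq_one.mp hmem

end FreeOrSurface

/-! ### Corollary 2.8 and Remark 2.8.1 (pp. 59–60) -/

/-- **Corollary 2.8 (Subgroups of Topological Fundamental Groups of Complex Hyperbolic
Curves)**, p. 59, as a named statement.  `Z` a hyperbolic curve over `ℂ`, `Π_Z` its usual
topological fundamental group — here an abstract group that is free of finite rank (`Z`
non-proper) or an orientable surface group (`Z` proper), `Π̂_Z` its profinite completion,
`η : Π_Z → Π̂_Z`; `H ⊆ Π_Z` an infinite subgroup [such as a cuspidal inertia group!]; `γ ∈ Π̂_Z` with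
`γ · η(H) · γ⁻¹ ⊆ η(Π_Z)`.  Then `γ · η(H) · γ⁻¹ = η(δ) · η(H) · η(δ)⁻¹` for some `δ ∈ Π_Z`
["`γ ∈ Π_Z · N_{Π̂_Z}(H)`, i.e., …"]; if, moreover, `H` is nonabelian, then `γ ∈ η(Π_Z)`.
Not asserted here (but see `subgroupsOfComplexHyperbolicPi1_of_thm26`).
[cite: Mochizuki2012, Cor 2.8 p.59] -/
def SubgroupsOfComplexHyperbolicPi1 : Prop :=
  ∀ (P : Type u) [Group P], IsFreeOrSurface P → ∀ H : Subgroup P, (H : Set P).Infinite →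
    ∀ γ : profiniteCompletion P,
      (∀ h ∈ H, γ * toCompletion P h * γ⁻¹ ∈ (toCompletion P).range) →
      (∃ δ : P, MulAut.conj γ • H.map (toCompletion P) =
          MulAut.conj (toCompletion P δ) • H.map (toCompletion P)) ∧
      ((∃ x ∈ H, ∃ y ∈ H, x * y ≠ y * x) → γ ∈ (toCompletion P).range)

/-- `IsFreeOfFiniteRank` is invariant under group isomorphism. [cite: Mochizuki2012, Thm 2.6 p.56] -/
theorem IsFreeOfFiniteRank.of_mulEquiv {G : Type u} [Group G] {G' : Type u} [Group G']
    (e : G ≃* G') (h : IsFreeOfFiniteRank G') : IsFreeOfFiniteRank G := by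
  obtain ⟨n, ⟨f⟩⟩ := h
  exact ⟨n, ⟨e.trans f⟩⟩

/-- `IsOrientableSurfaceGroup` is invariant under group isomorphism.
[cite: Mochizuki2012, Thm 2.6 p.56] -/
theorem IsOrientableSurfaceGroup.of_mulEquiv {G : Type u} [Group G] {G' : Type u} [Group G']
    (e : G ≃* G') (h : IsOrientableSurfaceGroup G') : IsOrientableSurfaceGroup G := by
  obtain ⟨g, hg, ⟨f⟩⟩ := h
  exact ⟨g, hg, ⟨e.trans f⟩⟩

/-- `IsFreeOrSurface` is invariant under group isomorphism. [cite: Mochizuki2012, Thm 2.6 p.56] -/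
theorem IsFreeOrSurface.of_mulEquiv {G : Type u} [Group G] {G' : Type u} [Group G']
    (e : G ≃* G') (h : IsFreeOrSurface G') : IsFreeOrSurface G :=
  h.elim (fun h => Or.inl (IsFreeOfFiniteRank.of_mulEquiv e h))
    fun h => Or.inr (IsOrientableSurfaceGroup.of_mulEquiv e h)

/-- **Remark 2.8.1**, p. 59: "Corollary 2.8 is an immediate consequence of Theorem 2.6" — apply
Theorem 2.6 with `F = G = Π_Z` (a subgroup of index `1`) and `H_G = H ∩ Π_Z = H`.
[cite: Mochizuki2012, Rmk 2.8.1 p.59] -/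
theorem subgroupsOfComplexHyperbolicPi1_of_thm26 (h : ProfiniteConjugatesOfDiscreteSubgroups.{u}) :
    SubgroupsOfComplexHyperbolicPi1.{u} := by
  intro P _ hP H hH γ hγ
  have htop : IsFreeOrSurface (⊤ : Subgroup P) := IsFreeOrSurface.of_mulEquiv Subgroup.topEquiv hP
  haveI : (⊤ : Subgroup P).FiniteIndex := inferInstance
  have h26 := h P ⊤ H inferInstance htop hH γ hγ
  rw [inf_top_eq] at h26
  exact h26

end Literature.IUT.HodgeTheaters
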